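/-
Copyright (c) 2026. All rights reserved.
Released under Apache 2.0 license as described in the file LICENSE.
Authors: abc-iut cell, seat abc-iut-L4-t10 (gen 4; D-0079 L-F table LF-ABSTOP rows F-0307 / F-0309 /
F-0310 / F-0305 — the printed items of [AbsTopIII] Cor 4.5 AT GENUINE Riemann-surface data).
-/
import Literature.AnabelianGeometry.AbsoluteAnabelian.ArchimedeanHolFieldFunctorGeometricPlaneComplTwist
import Literature.AnabelianGeometry.AbsoluteAnabelian.ArchimedeanHolFieldFunctorGeometricPuncturedEllipticOuter
import Literature.AnabelianGeometry.AbsoluteAnabelian.ArchimedeanHolFieldFunctorGeometricTripodCovers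
import HarnessLib

/-!
# [AbsTopIII] Cor 4.5 (i), (ii), (iii), (iv), (v) — the LITERAL printed items — at GENUINE data:
# the archimedean log-Frobenius data over `EA^hol_RS(Q_𝕏)` for the hyperbolic Riemann surfaces
# `𝕏 = ℂ ∖ {0,1}` (tripod), `𝕏 = ℂ ∖ F` (`|F| ≥ 2`), and `𝕏` a once-punctured elliptic curve

S. Mochizuki, *Topics in Absolute Anabelian Geometry III*, Cor. 4.5 (i)–(v) pp.107–109.
[cite: MochizukiAbsTopIII2015, Corollary 4.5 pp.107–109]

PROOF-ONLY file (seat abc-iut-L4-t10 gen 4).  The FACT-LIST rows F-0307 `Cor_4_5_ii`, F-0309 `Cor_4_5_iv`,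
F-0310 `Cor_4_5_v` (and the conjunction F-0305 `Cor_4_5`) are schemata on abstract `LogFrobeniusData`
whose universal closures are refuted (abc-iut-f-071 / f-070); what the cell's L-F table (plan/L4/LF-ABSTOP.tsv,
tier T2/T3) asks for is the INSTANCE AT GENUINE [AbsTop*] DATA.  This seat's geometric Cor 4.5 column
proves the conjunction `AbsTopIII.Cor_4_5` — with ZERO residual hypotheses — for the archimedean
log-Frobenius data of the interface datum `geometricAutHolFieldFunctor Q_𝕏` over Riemann surfaces
(`HolRS`, abc-iut-L4-t14) at: the tripod `ℂ ∖ {0,1}` (`cor_4_5_geometric_tripodCovers`, p441965), every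
finitely punctured plane `ℂ ∖ F` with two points (`cor_4_5_geometric_planeComplCovers`, p451316), every
once-punctured elliptic curve (`cor_4_5_geometric_mapsTo_of_isPuncturedEllipticCurve`, p450973).  Reading
these through `AbsTopIII.cor_4_5_iff` (for `ℂ ∖ F` and the elliptic case re-derived here directly from
`cor_4_5_geometric` and the id-rigidity theorems of abc-iut-L4-t12 / abc-iut-w5-d144, to keep the import
graph shallow) gives each printed item LITERALLY (the named `Prop`s of
`AbsTopIII/AutHolLogFrobenius.lean`) at genuine data:

* `cor_4_5_items_tripodCovers` — `Cor_4_5_i ∧ Cor_4_5_ii ∧ Cor_4_5_iii ∧ Cor_4_5_iv ∧ Cor_4_5_v` at the tripod;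
* `cor_4_5_ii_tripodCovers` / `_planeComplCovers` / `_of_isPuncturedEllipticCurve` — F-0307 instances;
* `cor_4_5_iv_tripodCovers` / `_planeComplCovers` / `_of_isPuncturedEllipticCurve` — F-0309 instances;
* `cor_4_5_v_tripodCovers` / `_planeComplCovers` / `_of_isPuncturedEllipticCurve` — F-0310 instances;
* `cor_4_5_i_tripodCovers`, `cor_4_5_iii_tripodCovers` — items (i), (iii) likewise.

HONEST SCOPE: MODEL level (OUR `HolRS` / `geometricAutHolFieldFunctor`); instance ≠ universal schema;
model ≠ reconstruction; support for the L-F table, not a node; nothing here bears on [IUTchIII] Cor. 3.12.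
No definitions, no instances, no named facts.
-/

noncomputable section

open CategoryTheory Set
open Literature.Topology.CoveringSpaces

namespace Literature.AnabelianGeometry.AbsoluteAnabelian

namespace HolRS

/-! ### The tripod `ℂ ∖ {0,1}` -/

/-- **All five printed items of Cor 4.5, literally, at the tripod** (`EA^hol_RS(Q_{ℂ∖{0,1}})`).
[cite: MochizukiAbsTopIII2015, Corollary 4.5 pp.107–109] -/
theorem cor_4_5_items_tripodCovers :
    AbsTopIII.Cor_4_5_i (archLogFrobeniusData (geometricAutHolFieldFunctor (fun Y : HolRS =>
        Nonempty (Y ⟶ planeComplFinite ({0, 1} : Set ℂ) (Set.toFinite _))))) ∧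
    AbsTopIII.Cor_4_5_ii (archLogFrobeniusData (geometricAutHolFieldFunctor (fun Y : HolRS =>
        Nonempty (Y ⟶ planeComplFinite ({0, 1} : Set ℂ) (Set.toFinite _)))))
      (archTelecoreData (geometricAutHolFieldFunctor (fun Y : HolRS =>
        Nonempty (Y ⟶ planeComplFinite ({0, 1} : Set ℂ) (Set.toFinite _))))) ∧
    AbsTopIII.Cor_4_5_iii (archLogFrobeniusData (geometricAutHolFieldFunctor (fun Y : HolRS =>
        Nonempty (Y ⟶ planeComplFinite ({0, 1} : Set ℂ) (Set.toFinite _))))) ∧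
    AbsTopIII.Cor_4_5_iv (archLogFrobeniusData (geometricAutHolFieldFunctor (fun Y : HolRS =>
        Nonempty (Y ⟶ planeComplFinite ({0, 1} : Set ℂ) (Set.toFinite _)))))
      (archTelecoreData (geometricAutHolFieldFunctor (fun Y : HolRS =>
        Nonempty (Y ⟶ planeComplFinite ({0, 1} : Set ℂ) (Set.toFinite _))))) ∧
    AbsTopIII.Cor_4_5_v (archLogFrobeniusData (geometricAutHolFieldFunctor (fun Y : HolRS =>
        Nonempty (Y ⟶ planeComplFinite ({0, 1} : Set ℂ) (Set.toFinite _))))) :=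
  (AbsTopIII.cor_4_5_iff _ _).mp cor_4_5_geometric_tripodCovers

/-- **Cor 4.5 (i) at the tripod.** [cite: MochizukiAbsTopIII2015, Corollary 4.5 (i) p.107] -/
theorem cor_4_5_i_tripodCovers :
    AbsTopIII.Cor_4_5_i (archLogFrobeniusData (geometricAutHolFieldFunctor (fun Y : HolRS =>
        Nonempty (Y ⟶ planeComplFinite ({0, 1} : Set ℂ) (Set.toFinite _))))) :=
  cor_4_5_items_tripodCovers.1

/-- **Cor 4.5 (ii) (F-0307 `Cor_4_5_ii`) at the tripod.**
[cite: MochizukiAbsTopIII2015, Corollary 4.5 (ii) p.108] -/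
theorem cor_4_5_ii_tripodCovers :
    AbsTopIII.Cor_4_5_ii (archLogFrobeniusData (geometricAutHolFieldFunctor (fun Y : HolRS =>
        Nonempty (Y ⟶ planeComplFinite ({0, 1} : Set ℂ) (Set.toFinite _)))))
      (archTelecoreData (geometricAutHolFieldFunctor (fun Y : HolRS =>
        Nonempty (Y ⟶ planeComplFinite ({0, 1} : Set ℂ) (Set.toFinite _))))) :=
  cor_4_5_items_tripodCovers.2.1

/-- **Cor 4.5 (iii) at the tripod.** [cite: MochizukiAbsTopIII2015, Corollary 4.5 (iii) p.108] -/
theorem cor_4_5_iii_tripodCovers :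
    AbsTopIII.Cor_4_5_iii (archLogFrobeniusData (geometricAutHolFieldFunctor (fun Y : HolRS =>
        Nonempty (Y ⟶ planeComplFinite ({0, 1} : Set ℂ) (Set.toFinite _))))) :=
  cor_4_5_items_tripodCovers.2.2.1

/-- **Cor 4.5 (iv) (F-0309 `Cor_4_5_iv`) at the tripod.**
[cite: MochizukiAbsTopIII2015, Corollary 4.5 (iv) p.109] -/
theorem cor_4_5_iv_tripodCovers :
    AbsTopIII.Cor_4_5_iv (archLogFrobeniusData (geometricAutHolFieldFunctor (fun Y : HolRS =>
        Nonempty (Y ⟶ planeComplFinite ({0, 1} : Set ℂ) (Set.toFinite _)))))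
      (archTelecoreData (geometricAutHolFieldFunctor (fun Y : HolRS =>
        Nonempty (Y ⟶ planeComplFinite ({0, 1} : Set ℂ) (Set.toFinite _))))) :=
  cor_4_5_items_tripodCovers.2.2.2.1

/-- **Cor 4.5 (v) (F-0310 `Cor_4_5_v`) at the tripod.**
[cite: MochizukiAbsTopIII2015, Corollary 4.5 (v) p.109] -/
theorem cor_4_5_v_tripodCovers :
    AbsTopIII.Cor_4_5_v (archLogFrobeniusData (geometricAutHolFieldFunctor (fun Y : HolRS =>
        Nonempty (Y ⟶ planeComplFinite ({0, 1} : Set ℂ) (Set.toFinite _))))) :=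
  cor_4_5_items_tripodCovers.2.2.2.2

/-! ### Every finitely punctured plane `ℂ ∖ F`, `|F| ≥ 2` -/

variable {F : Set ℂ} (hF : F.Finite)

/-- **Cor 4.5 (ii) (F-0307) at `ℂ ∖ F`**, every finite `F` with two distinct points.
[cite: MochizukiAbsTopIII2015, Corollary 4.5 (ii) p.108] -/
theorem cor_4_5_ii_planeComplCovers {p₁ p₂ : ℂ} (hp₁ : p₁ ∈ F) (hp₂ : p₂ ∈ F) (hp : p₁ ≠ p₂) :
    AbsTopIII.Cor_4_5_ii (archLogFrobeniusData (geometricAutHolFieldFunctor (fun Y : HolRS =>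
        Nonempty (Y ⟶ planeComplFinite F hF))))
      (archTelecoreData (geometricAutHolFieldFunctor (fun Y : HolRS =>
        Nonempty (Y ⟶ planeComplFinite F hF)))) :=
  ((AbsTopIII.cor_4_5_iff _ _).mp (cor_4_5_geometric _ ⟨planeComplFinite F hF, ⟨𝟙 _⟩⟩
    (isIdRigid_mapsTo_planeComplFinite hF hp₁ hp₂ hp))).2.1

/-- **Cor 4.5 (iv) (F-0309) at `ℂ ∖ F`.**
[cite: MochizukiAbsTopIII2015, Corollary 4.5 (iv) p.109] -/
theorem cor_4_5_iv_planeComplCovers {p₁ p₂ : ℂ} (hp₁ : p₁ ∈ F) (hp₂ : p₂ ∈ F) (hp : p₁ ≠ p₂) :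
    AbsTopIII.Cor_4_5_iv (archLogFrobeniusData (geometricAutHolFieldFunctor (fun Y : HolRS =>
        Nonempty (Y ⟶ planeComplFinite F hF))))
      (archTelecoreData (geometricAutHolFieldFunctor (fun Y : HolRS =>
        Nonempty (Y ⟶ planeComplFinite F hF)))) :=
  ((AbsTopIII.cor_4_5_iff _ _).mp (cor_4_5_geometric _ ⟨planeComplFinite F hF, ⟨𝟙 _⟩⟩
    (isIdRigid_mapsTo_planeComplFinite hF hp₁ hp₂ hp))).2.2.2.1

/-- **Cor 4.5 (v) (F-0310) at `ℂ ∖ F`.** [cite: MochizukiAbsTopIII2015, Corollary 4.5 (v) p.109] -/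
theorem cor_4_5_v_planeComplCovers {p₁ p₂ : ℂ} (hp₁ : p₁ ∈ F) (hp₂ : p₂ ∈ F) (hp : p₁ ≠ p₂) :
    AbsTopIII.Cor_4_5_v (archLogFrobeniusData (geometricAutHolFieldFunctor (fun Y : HolRS =>
        Nonempty (Y ⟶ planeComplFinite F hF)))) :=
  ((AbsTopIII.cor_4_5_iff _ _).mp (cor_4_5_geometric _ ⟨planeComplFinite F hF, ⟨𝟙 _⟩⟩
    (isIdRigid_mapsTo_planeComplFinite hF hp₁ hp₂ hp))).2.2.2.2

/-! ### Every once-punctured elliptic curve -/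

/-- **Cor 4.5 (ii) (F-0307) at a once-punctured elliptic curve `𝕏`.**
[cite: MochizukiAbsTopIII2015, Corollary 4.5 (ii) p.108] -/
theorem cor_4_5_ii_mapsTo_of_isPuncturedEllipticCurve (X : HolRS)
    (hX : TorsionPointsDenseUniqueGroupLaw.IsPuncturedEllipticCurve X.carrier) :
    AbsTopIII.Cor_4_5_ii
      (archLogFrobeniusData (geometricAutHolFieldFunctor (fun Y : HolRS => Nonempty (Y ⟶ X))))
      (archTelecoreData (geometricAutHolFieldFunctor (fun Y : HolRS => Nonempty (Y ⟶ X)))) :=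
  ((AbsTopIII.cor_4_5_iff _ _).mp (cor_4_5_geometric _ ⟨X, ⟨𝟙 X⟩⟩
    (X.isIdRigid_mapsTo_of_isPuncturedEllipticCurve hX))).2.1

/-- **Cor 4.5 (iv) (F-0309) at a once-punctured elliptic curve `𝕏`.**
[cite: MochizukiAbsTopIII2015, Corollary 4.5 (iv) p.109] -/
theorem cor_4_5_iv_mapsTo_of_isPuncturedEllipticCurve (X : HolRS)
    (hX : TorsionPointsDenseUniqueGroupLaw.IsPuncturedEllipticCurve X.carrier) :
    AbsTopIII.Cor_4_5_iv
      (archLogFrobeniusData (geometricAutHolFieldFunctor (fun Y : HolRS => Nonempty (Y ⟶ X))))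
      (archTelecoreData (geometricAutHolFieldFunctor (fun Y : HolRS => Nonempty (Y ⟶ X)))) :=
  ((AbsTopIII.cor_4_5_iff _ _).mp (cor_4_5_geometric _ ⟨X, ⟨𝟙 X⟩⟩
    (X.isIdRigid_mapsTo_of_isPuncturedEllipticCurve hX))).2.2.2.1

/-- **Cor 4.5 (v) (F-0310) at a once-punctured elliptic curve `𝕏`.**
[cite: MochizukiAbsTopIII2015, Corollary 4.5 (v) p.109] -/
theorem cor_4_5_v_mapsTo_of_isPuncturedEllipticCurve (X : HolRS)
    (hX : TorsionPointsDenseUniqueGroupLaw.IsPuncturedEllipticCurve X.carrier) :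
    AbsTopIII.Cor_4_5_v
      (archLogFrobeniusData (geometricAutHolFieldFunctor (fun Y : HolRS => Nonempty (Y ⟶ X)))) :=
  ((AbsTopIII.cor_4_5_iff _ _).mp (cor_4_5_geometric _ ⟨X, ⟨𝟙 X⟩⟩
    (X.isIdRigid_mapsTo_of_isPuncturedEllipticCurve hX))).2.2.2.2

end HolRS

end Literature.AnabelianGeometry.AbsoluteAnabelian
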